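import Mathlib

/-!
# LatticeQCDFlow / Scaling — the Gaussian (log-normal) log-weight law (T2-J)

HONEST FRAMING: exact (Metropolis-corrected) sampling algorithms for lattice gauge theory;
figures of merit are autocorrelation/cost numbers at stated couplings and volumes; no
continuum-physics claim.

Venture `LatticeQCDFlow` (cell pub-lqcd), topic `Scaling`, item T2-J of HOME/THEORY-2.md §4
(v1.1), landed by FANOUT row 31 from `HOME/THEORY-2-Sketch.lean` (theory seat, decls verbatim).
If the log-weight `ℓ = log w` is Gaussian `N(m, v)` under the model (the regime reported for
trained flows at large volume, where `log w` is a sum of many weakly dependent local terms) and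
the weights are normalised (`E w = 1`), then `m = -v/2`, `E w² = e^v`, so `ESS/N = exp(-v)`
(`gaussian_logweight_law`, `gaussian_logweight_ess`, via Mathlib `mgf_gaussianReal`) and the
reverse KL is `E_q[-log w] = v/2` (`gaussian_logweight_reverseKL`).  With `v = Var(log w) ∝ V`
this is the quantitative volume law of the printed literature; the `erfc` acceptance formula is
not typed (no `erfc` in Mathlib).
-/

namespace Summit.Ventures.LatticeQCDFlow.Theory2

section Gaussian

open MeasureTheory ProbabilityTheory
open scoped NNReal

/-! ## T2-J: the Gaussian (log-normal) log-weight law -/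

/-- **T2-J (Gaussian log-weight law; proved).**  If the log-weight `ℓ = log (p/q)` of a model
sample is Gaussian `N(m, v)` under the model and the weights are normalised (`E_q[w] = E[e^ℓ] = 1`,
i.e. `mgf ℓ 1 = 1`), then necessarily `m = −v/2`, and the second moment of the weights is
`E_q[w²] = mgf ℓ 2 = e^{v}` — so the reweighting efficiency is `ESS/N = (E w)²/E[w²] = e^{−v}`:
EXPONENTIALLY small in the log-weight variance.  With `v = Var_q(log w)` extensive in the volume
(a sum of weakly dependent local defects, T2-G/T2-I), this is the `ESS = exp(−c·V)` law reported
in the volume-scaling studies (Abbott et al. 2022, arXiv:2211.07541; Del Debbio et al. 2021,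
arXiv:2105.12481) in its cleanest form. [folklore] -/
theorem gaussian_logweight_law {Ω : Type*} [MeasurableSpace Ω] {P : Measure Ω} {ℓ : Ω → ℝ}
    {m : ℝ} {v : ℝ≥0} (hℓ : P.map ℓ = gaussianReal m v) (hnorm : mgf ℓ P 1 = 1) :
    m = -(v : ℝ) / 2 ∧ mgf ℓ P 2 = Real.exp v := by
  have h1 := mgf_gaussianReal hℓ 1
  rw [hnorm] at h1
  have hm : m + (v : ℝ) / 2 = 0 := by
    have := Real.exp_eq_one_iff _ |>.1 h1.symm
    linarith
  refine ⟨by linarith, ?_⟩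
  rw [mgf_gaussianReal hℓ 2]
  congr 1
  linarith

/-- Corollary: the normalised ESS `(E w)² / E[w²] = mgf ℓ 1 ^ 2 / mgf ℓ 2` equals `e^{−v}`. -/
theorem gaussian_logweight_ess {Ω : Type*} [MeasurableSpace Ω] {P : Measure Ω} {ℓ : Ω → ℝ}
    {m : ℝ} {v : ℝ≥0} (hℓ : P.map ℓ = gaussianReal m v) (hnorm : mgf ℓ P 1 = 1) :
    mgf ℓ P 1 ^ 2 / mgf ℓ P 2 = Real.exp (-(v : ℝ)) := by
  rw [(gaussian_logweight_law hℓ hnorm).2, hnorm, one_pow, Real.exp_neg, one_div]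

/-- The two KL divergences in the Gaussian log-weight model: reverse `KL(q‖p) = E_q[−ℓ] = v/2`
(the TRAINING loss) — read off the mean; (forward `KL(p‖q) = E_p[ℓ] = m + v = v/2` as well, by
the exponential tilt; not formalised). -/
theorem gaussian_logweight_reverseKL {Ω : Type*} [MeasurableSpace Ω] {P : Measure Ω}
    [IsProbabilityMeasure P] {ℓ : Ω → ℝ} (hℓm : AEMeasurable ℓ P)
    {m : ℝ} {v : ℝ≥0} (hℓ : P.map ℓ = gaussianReal m v) (hnorm : mgf ℓ P 1 = 1) :
    ∫ ω, -ℓ ω ∂P = (v : ℝ) / 2 := by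
  have hmean : ∫ ω, ℓ ω ∂P = m := by
    have := integral_map hℓm (aestronglyMeasurable_id : AEStronglyMeasurable (id : ℝ → ℝ) (P.map ℓ))
    simp only [id] at this
    rw [← this, hℓ, integral_id_gaussianReal]
  rw [integral_neg, hmean, (gaussian_logweight_law hℓ hnorm).1]
  ring

end Gaussian

end Summit.Ventures.LatticeQCDFlow.Theory2
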